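import Literature.Analysis.OperatorTheory.GroundStateMarkovGap
import Literature.Analysis.OperatorTheory.KernelDirichletForm
import Literature.Probability.MarkovChains.CheegerInequalityGeneralStateSpace
import Literature.MathematicalPhysics.QuantumFieldTheory.ConstructiveQFTWave0Proofs
import HarnessLib

/-!
# Crux `IR` (stmt-QuantumFields-19354), line `vacuum_escape`, seam `stub_cheeger` — part 2: the ground-state coupling of a positive
# transfer kernel and the Lawler–Sokal (Cheeger) bound on the excited spectrum

Helper module for item `stmt-QuantumFields-19354` (`--supports … --as helper`; closes nothing by itself).  Abstract setting: a probability
space `(X, μ)`, a bounded symmetric strongly measurable kernel `K ≥ 0` with a pointwise GROUND STATE `h` (`∫ K(x,y) h(y) dμ(y) = λ₀ h(x)`,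
`0 < h₀ ≤ h ≤ B`, `∫ h² dμ = 1`; tree `PositiveKernelEigenfunction.exists_pointwise_eigenfunction` for strictly positive kernels).  The
ground-state (Doob `h`-) transform of the chain with transition weight `K` is the stationary Markov chain with invariant law
`π = h² dμ` and step coupling `ρ(dx,dy) = λ₀⁻¹ h(x) K(x,y) h(y) dμ(x) dμ(y)` (both marginals `π`).  This file PROVES:

* `integral_mul_kernel_mul_le_of_conductance` — if every measurable `A` has CONDUCTANCE `k`,
  `k · π(A)(1 − π(A)) ≤ π(A) − λ₀⁻¹ ∫_A ∫_A h K h` (`= ρ(A × Aᶜ)`), then for every bounded measurable `F` with `∫ F h² dμ = 0`,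
  `∫∫ (Fh)(x) K(x,y) (Fh)(y) ≤ λ₀ (1 − k²/8) ∫ F² h²` — the tree's general-state-space Cheeger inequality of Lawler–Sokal
  (`Literature.Probability.MarkovChains.cheeger_variance_le_dirichletForm`, Trans. AMS 309 (1988) Thm 2.1) applied to the coupling `ρ`,
  combined with the Dirichlet-form identity of the ground-state transform (`KernelDirichletForm.integral_mul_kernel_mul_eq_of_eigenfunction`);
* `eigenvalue_le_of_conductance` — consequently every eigenvector `bᵢ` of the `L²` operator of `K` orthogonal to `h` has eigenvalue
  `λᵢ ≤ λ₀ (1 − k²/8)` (trial function `F = bᵢ/h`, using the bounded version `λᵢ⁻¹ κ bᵢ` of `bᵢ`);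
* `exists_groundState_data` — the pointwise ground state of a strictly positive kernel sits in a given eigenbasis: `b_{i₀} = ±[h]`,
  `⟪[h], bᵢ⟫ = 0` and `λᵢ ≤ θ < λ₀` for `i ≠ i₀` (Jentzsch's gap, tree `IsPositivityImproving.exists_spectralGap`,
  `GroundStateMarkovGap.toLp_eigenfunction_eq_norm`), and `h ≥ h₀ > 0` from a uniform lower bound of the kernel.

Part 3 specialises to the Wilson slice kernel and closes `VacuumEscape.stub_cheeger`.  HONEST FRAMING: Markov-chain / transfer-operator
analysis; nothing here bears on weak coupling or the YM mass gap.
Refs: G. F. Lawler, A. D. Sokal, Trans. AMS 309 (1988) 557, Thm 2.1; M. Reed, B. Simon IV, Thm XIII.43–44; tree files named above.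
-/

set_option autoImplicit false

noncomputable section

open MeasureTheory Filter Set Function
open scoped RealInnerProductSpace ENNReal Topology
open Literature.Analysis.OperatorTheory Literature.Probability.MarkovChains

namespace Summit.QuantumFields.YangMills.Cruxes.IR.VacuumEscape.GroundState

variable {X : Type*} [MeasurableSpace X] {μ : Measure X} [IsProbabilityMeasure μ]
  {K : X → X → ℝ} {C : ℝ}

/-! ## The ground-state coupling and the Cheeger bound -/

/-- `‖a b‖ ≤ A B` from `‖a‖ ≤ A`, `‖b‖ ≤ B`, `0 ≤ A` (helper). -/
theorem norm_mul_le_of_le {a b A B : ℝ} (ha : ‖a‖ ≤ A) (hb : ‖b‖ ≤ B) (hA : 0 ≤ A) : ‖a * b‖ ≤ A * B := by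
  rw [norm_mul]; exact mul_le_mul ha hb (norm_nonneg _) hA

/-- Bounded measurable functions are integrable on a finite measure space (helper). -/
theorem integrable_of_bdd {Y : Type*} [MeasurableSpace Y] {ν : Measure Y} [IsFiniteMeasure ν] {g : Y → ℝ}
    (hg : Measurable g) {B : ℝ} (hB : ∀ y, ‖g y‖ ≤ B) : Integrable g ν :=
  Integrable.of_bound hg.aestronglyMeasurable B (Eventually.of_forall hB)

/-- **Cheeger bound for the ground-state transform.**  `K ≥ 0` bounded symmetric strongly measurable, `h` a bounded non-negative
pointwise eigenfunction (`∫ K(x,y)h(y) = λ₀ h(x)`, `λ₀ > 0`, `∫ h² = 1`); if every measurable `A` has conductance `k ≥ 0` in the sense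
`k·P(A)(1 − P(A)) ≤ P(A) − λ₀⁻¹∫_A∫_A hKh`, `P(A) = ∫_A h²`, then for bounded measurable `F` with `∫ F h² = 0`:
`∫∫ (Fh)(x)K(x,y)(Fh)(y) ≤ λ₀ (1 − k²/8) ∫ F²h²` (Lawler–Sokal Thm 2.1 for the coupling `λ₀⁻¹ hKh dμdμ`, marginals `h²dμ`). -/
theorem integral_mul_kernel_mul_le_of_conductance
    (hK : StronglyMeasurable (uncurry K)) (hC : ∀ x y, ‖K x y‖ ≤ C) (hsymm : ∀ x y, K x y = K y x) (hKnn : ∀ x y, 0 ≤ K x y)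
    {h : X → ℝ} (hhm : Measurable h) {B : ℝ} (hhB : ∀ x, ‖h x‖ ≤ B) (hh0 : ∀ x, 0 ≤ h x)
    {lam₀ : ℝ} (hlam₀ : 0 < lam₀) (heig : ∀ x, ∫ y, K x y * h y ∂μ = lam₀ * h x) (hnorm : ∫ x, h x ^ 2 ∂μ = 1)
    {k : ℝ} (hk : 0 ≤ k)
    (hcond : ∀ A : Set X, MeasurableSet A →
      k * (∫ x in A, h x ^ 2 ∂μ) * (1 - ∫ x in A, h x ^ 2 ∂μ) ≤
        (∫ x in A, h x ^ 2 ∂μ) - lam₀⁻¹ * ∫ x in A, ∫ y in A, h x * K x y * h y ∂μ ∂μ)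
    {F : X → ℝ} (hFm : Measurable F) {CF : ℝ} (hFb : ∀ x, |F x| ≤ CF) (hF0 : ∫ x, F x * h x ^ 2 ∂μ = 0) :
    ∫ x, ∫ y, (F x * h x) * K x y * (F y * h y) ∂μ ∂μ ≤ lam₀ * (1 - k ^ 2 / 8) * ∫ x, F x ^ 2 * h x ^ 2 ∂μ := by
  have hμu : μ (univ : Set X) ≠ 0 := by rw [measure_univ]; exact one_ne_zero
  obtain ⟨x₀, -⟩ : (univ : Set X).Nonempty := nonempty_of_measure_ne_zero hμu
  have hB0 : 0 ≤ B := (norm_nonneg _).trans (hhB x₀)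
  have hC0 : 0 ≤ C := (norm_nonneg _).trans (hC x₀ x₀)
  have hCF0 : 0 ≤ CF := (abs_nonneg _).trans (hFb x₀)
  have hFb' : ∀ x, ‖F x‖ ≤ CF := fun x => by rw [Real.norm_eq_abs]; exact hFb x
  have hKm : Measurable (uncurry K) := hK.measurable
  -- the density of the ground-state coupling
  set D : X × X → ℝ := fun p => lam₀⁻¹ * (h p.1 * K p.1 p.2 * h p.2) with hD
  have hDm : Measurable D :=
    measurable_const.mul (((hhm.comp measurable_fst).mul hKm).mul (hhm.comp measurable_snd))
  have hD0 : ∀ p, 0 ≤ D p := fun p =>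
    mul_nonneg (inv_nonneg.2 hlam₀.le) (mul_nonneg (mul_nonneg (hh0 _) (hKnn _ _)) (hh0 _))
  have hDb : ∀ p, ‖D p‖ ≤ lam₀⁻¹ * (B * C * B) := by
    intro p
    rw [Real.norm_eq_abs, abs_of_nonneg (hD0 p), hD]
    refine mul_le_mul_of_nonneg_left ?_ (inv_nonneg.2 hlam₀.le)
    have h1 : h p.1 ≤ B := (le_abs_self _).trans ((Real.norm_eq_abs _).symm.le.trans (hhB p.1))
    have h2 : h p.2 ≤ B := (le_abs_self _).trans ((Real.norm_eq_abs _).symm.le.trans (hhB p.2))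
    have h3 : K p.1 p.2 ≤ C := (le_abs_self _).trans ((Real.norm_eq_abs _).symm.le.trans (hC p.1 p.2))
    exact mul_le_mul (mul_le_mul h1 h3 (hKnn _ _) hB0) h2 (hh0 _) (mul_nonneg hB0 hC0)
  have hDi : Integrable D (μ.prod μ) := integrable_of_bdd hDm hDb
  -- the measures
  set π : Measure X := μ.withDensity (fun x => ENNReal.ofReal (h x ^ 2)) with hπ
  set ρ : Measure (X × X) := (μ.prod μ).withDensity (fun p => ENNReal.ofReal (D p)) with hρ
  have hh2m : Measurable fun x => h x ^ 2 := hhm.pow_const 2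
  have hh2b : ∀ x, ‖h x ^ 2‖ ≤ B ^ 2 := fun x => by
    rw [Real.norm_eq_abs, abs_of_nonneg (sq_nonneg _)]
    have := hhB x
    rw [Real.norm_eq_abs] at this
    calc h x ^ 2 = |h x| ^ 2 := (sq_abs _).symm
      _ ≤ B ^ 2 := pow_le_pow_left₀ (abs_nonneg _) this 2
  have hh2i : Integrable (fun x => h x ^ 2) μ := integrable_of_bdd hh2m hh2b
  haveI hπprob : IsProbabilityMeasure π := by
    refine ⟨?_⟩
    rw [hπ, withDensity_apply _ MeasurableSet.univ, Measure.restrict_univ,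
      ← ofReal_integral_eq_lintegral_ofReal hh2i (Eventually.of_forall fun x => sq_nonneg (h x)), hnorm, ENNReal.ofReal_one]
  haveI hρfin : IsFiniteMeasure ρ := by
    rw [hρ]
    exact isFiniteMeasure_withDensity_ofReal hDi.2
  -- integrals against `π` and `ρ`
  have hπint : ∀ g : X → ℝ, ∫ x, g x ∂π = ∫ x, h x ^ 2 * g x ∂μ := by
    intro g
    rw [hπ, integral_withDensity_eq_integral_toReal_smul hh2m.ennreal_ofReal
      (Eventually.of_forall fun x => ENNReal.ofReal_lt_top)]
    refine integral_congr_ae (Eventually.of_forall fun x => ?_)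
    simp only [smul_eq_mul]
    rw [ENNReal.toReal_ofReal (sq_nonneg _)]
  have hρint : ∀ g : X × X → ℝ, ∫ p, g p ∂ρ = ∫ p, D p * g p ∂(μ.prod μ) := by
    intro g
    rw [hρ, integral_withDensity_eq_integral_toReal_smul hDm.ennreal_ofReal
      (Eventually.of_forall fun p => ENNReal.ofReal_lt_top)]
    refine integral_congr_ae (Eventually.of_forall fun p => ?_)
    simp only [smul_eq_mul]
    rw [ENNReal.toReal_ofReal (hD0 p)]
  -- measures of measurable sets / rectangles
  have hπA : ∀ A : Set X, MeasurableSet A → π.real A = ∫ x in A, h x ^ 2 ∂μ := by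
    intro A hA
    rw [measureReal_def, hπ, withDensity_apply _ hA,
      ← ofReal_integral_eq_lintegral_ofReal hh2i.integrableOn (Eventually.of_forall fun x => sq_nonneg (h x)),
      ENNReal.toReal_ofReal (setIntegral_nonneg hA fun x _ => sq_nonneg _)]
  have hρAE : ∀ A E : Set X, MeasurableSet A → MeasurableSet E →
      ρ.real (A ×ˢ E) = ∫ x in A, ∫ y in E, D (x, y) ∂μ ∂μ := by
    intro A E hA hE
    rw [measureReal_def, hρ, withDensity_apply _ (hA.prod hE),
      ← ofReal_integral_eq_lintegral_ofReal hDi.integrableOn (Eventually.of_forall fun p => hD0 p),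
      ENNReal.toReal_ofReal (setIntegral_nonneg (hA.prod hE) fun p _ => hD0 p),
      setIntegral_prod D hDi.integrableOn]
  -- the row integral of the density: `∫ D(x, y) dμ(y) = h(x)²`
  have hrow : ∀ x, ∫ y, D (x, y) ∂μ = h x ^ 2 := by
    intro x
    simp only [hD]
    rw [integral_const_mul]
    have : ∫ y, h x * K x y * h y ∂μ = h x * ∫ y, K x y * h y ∂μ := by
      rw [← integral_const_mul]
      refine integral_congr_ae (Eventually.of_forall fun y => ?_); ring
    rw [this, heig x]
    field_simp
  -- marginals
  have hfst : ρ.fst = π := by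
    refine Measure.ext fun s hs => ?_
    have e1 : ρ.fst s = ρ (s ×ˢ (univ : Set X)) := by rw [Measure.fst_apply hs, ← prod_univ]
    have e2 : (ρ (s ×ˢ (univ : Set X))).toReal = (π s).toReal := by
      rw [← measureReal_def, ← measureReal_def, hρAE s univ hs MeasurableSet.univ, hπA s hs]
      refine setIntegral_congr_fun hs fun x _ => ?_
      rw [Measure.restrict_univ]
      exact hrow x
    rw [e1]
    exact (ENNReal.toReal_eq_toReal_iff' (measure_ne_top _ _) (measure_ne_top _ _)).1 e2
  have hDsw : ∀ p : X × X, D (Prod.swap p) = D p := fun p => by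
    simp only [hD, Prod.fst_swap, Prod.snd_swap, hsymm p.2 p.1]; ring
  have hswap : ρ.map Prod.swap = ρ := by
    have hsw : (μ.prod μ).map Prod.swap = μ.prod μ := Measure.prod_swap
    ext s hs
    rw [Measure.map_apply measurable_swap hs, hρ, withDensity_apply _ (measurable_swap hs), withDensity_apply _ hs]
    conv_rhs => rw [← hsw]
    rw [Measure.restrict_map measurable_swap hs, lintegral_map hDm.ennreal_ofReal measurable_swap]
    simp only [hDsw]
  have hsnd : ρ.snd = π := by rw [← Measure.fst_map_swap, hswap, hfst]
  -- the conductance hypothesis in coupling form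
  have hcond' : HasCouplingConductance π ρ k := by
    intro A hA
    have hP := hπA A hA
    have hPc : π.real Aᶜ = 1 - ∫ x in A, h x ^ 2 ∂μ := by rw [probReal_compl_eq_one_sub hA, hP]
    have hR : ρ.real (A ×ˢ Aᶜ) = (∫ x in A, h x ^ 2 ∂μ) - lam₀⁻¹ * ∫ x in A, ∫ y in A, h x * K x y * h y ∂μ ∂μ := by
      rw [hρAE A Aᶜ hA hA.compl]
      have hDx : ∀ x, Integrable (fun y => D (x, y)) μ := fun x =>
        integrable_of_bdd (hDm.comp measurable_prodMk_left) fun y => hDb (x, y)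
      have hin : ∀ x, ∫ y in Aᶜ, D (x, y) ∂μ = h x ^ 2 - ∫ y in A, D (x, y) ∂μ := by
        intro x
        rw [setIntegral_compl hA (hDx x), hrow x]
      simp_rw [hin]
      have hDunc : StronglyMeasurable (uncurry fun x y => D (x, y)) :=
        (hDm.comp (measurable_fst.prodMk measurable_snd)).stronglyMeasurable
      rw [integral_sub hh2i.integrableOn ?_]
      · congr 1
        rw [← integral_const_mul]
        refine setIntegral_congr_fun hA fun x _ => ?_
        rw [← integral_const_mul]
      · -- integrability of `x ↦ ∫_A D(x,y) dy` on `A`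
        refine (integrable_of_bdd (B := lam₀⁻¹ * (B * C * B) * μ.real univ) ?_ fun x => ?_).integrableOn
        · exact (hDunc.integral_prod_right' (ν := μ.restrict A)).measurable
        · rw [Real.norm_eq_abs]
          calc |∫ y in A, D (x, y) ∂μ| ≤ ∫ y in A, |D (x, y)| ∂μ := abs_integral_le_integral_abs
            _ ≤ ∫ y in A, lam₀⁻¹ * (B * C * B) ∂μ := by
                refine setIntegral_mono_on ?_ ?_ hA fun y _ => ?_
                · exact (hDx x).abs.integrableOn
                · exact (integrable_const _).integrableOn
                · have := hDb (x, y); rwa [Real.norm_eq_abs] at this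
            _ = lam₀⁻¹ * (B * C * B) * μ.real A := by rw [setIntegral_const, smul_eq_mul, mul_comm]
            _ ≤ lam₀⁻¹ * (B * C * B) * μ.real univ :=
                mul_le_mul_of_nonneg_left (measureReal_mono (subset_univ _) (measure_ne_top _ _))
                  (mul_nonneg (inv_nonneg.2 hlam₀.le) (mul_nonneg (mul_nonneg hB0 hC0) hB0))
    rw [hP, hPc, hR]
    exact hcond A hA
  -- Lawler–Sokal for the coupling
  have hcheeger := cheeger_variance_le_dirichletForm hfst hsnd hk hcond' hFm hFb
  have hmean : ∫ y, F y ∂π = 0 := by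
    rw [hπint]
    rw [show (fun x => h x ^ 2 * F x) = fun x => F x * h x ^ 2 from funext fun x => mul_comm _ _]
    exact hF0
  have hvar : ∫ x, (F x - ∫ y, F y ∂π) ^ 2 ∂π = ∫ x, F x ^ 2 * h x ^ 2 ∂μ := by
    rw [hmean, hπint]
    refine integral_congr_ae (Eventually.of_forall fun x => ?_)
    simp only [sub_zero]; ring
  have hdir : couplingDirichletForm ρ F = 1 / 2 * (lam₀⁻¹ * ∫ x, ∫ y, h x * K x y * h y * (F x - F y) ^ 2 ∂μ ∂μ) := by
    unfold couplingDirichletForm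
    congr 1
    rw [hρint, integral_prod _ ?_]
    · rw [← integral_const_mul]
      refine integral_congr_ae (Eventually.of_forall fun x => ?_)
      dsimp only
      rw [← integral_const_mul]
      refine integral_congr_ae (Eventually.of_forall fun y => ?_)
      simp only [hD]; ring
    · refine integrable_of_bdd (hDm.mul ((hFm.comp measurable_fst).sub (hFm.comp measurable_snd) |>.pow_const 2))
        (B := lam₀⁻¹ * (B * C * B) * (2 * CF) ^ 2) fun p => ?_
      refine norm_mul_le_of_le (hDb p) ?_ (mul_nonneg (inv_nonneg.2 hlam₀.le) (mul_nonneg (mul_nonneg hB0 hC0) hB0))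
      rw [Real.norm_eq_abs, abs_of_nonneg (sq_nonneg _), ← sq_abs]
      refine pow_le_pow_left₀ (abs_nonneg _) ?_ 2
      calc |F p.1 - F p.2| ≤ |F p.1| + |F p.2| := abs_sub _ _
        _ ≤ CF + CF := add_le_add (hFb _) (hFb _)
        _ = 2 * CF := by ring
  -- the Dirichlet-form identity of the ground-state transform
  have hBCB : 0 ≤ B * C * B := mul_nonneg (mul_nonneg hB0 hC0) hB0
  have hhKh : ∀ p : X × X, ‖h p.1 * K p.1 p.2 * h p.2‖ ≤ B * C * B := fun p =>
    norm_mul_le_of_le (norm_mul_le_of_le (hhB _) (hC _ _) hB0) (hhB _) (mul_nonneg hB0 hC0)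
  have hmeas_hKh : Measurable fun p : X × X => h p.1 * K p.1 p.2 * h p.2 :=
    ((hhm.comp measurable_fst).mul hKm).mul (hhm.comp measurable_snd)
  have hI : Integrable (fun p : X × X => F p.1 * (h p.1 * K p.1 p.2 * h p.2) * F p.2) (μ.prod μ) := by
    refine integrable_of_bdd (((hFm.comp measurable_fst).mul hmeas_hKh).mul (hFm.comp measurable_snd))
      (B := CF * (B * C * B) * CF) fun p => ?_
    exact norm_mul_le_of_le (norm_mul_le_of_le (hFb' _) (hhKh p) hCF0) (hFb' _) (mul_nonneg hCF0 hBCB)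
  have hI₁ : Integrable (fun p : X × X => h p.1 * K p.1 p.2 * h p.2 * F p.1 ^ 2) (μ.prod μ) := by
    refine integrable_of_bdd (hmeas_hKh.mul ((hFm.comp measurable_fst).pow_const 2)) (B := B * C * B * CF ^ 2) fun p => ?_
    refine norm_mul_le_of_le (hhKh p) ?_ hBCB
    rw [Real.norm_eq_abs, abs_of_nonneg (sq_nonneg _), ← sq_abs]
    exact pow_le_pow_left₀ (abs_nonneg _) (hFb _) 2
  have hident := Literature.Analysis.OperatorTheory.KernelDirichlet.integral_mul_kernel_mul_eq_of_eigenfunction (μ := μ) K F h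
    hsymm (Eventually.of_forall heig) hI hI₁
  rw [hident]
  -- combine
  have hE : k ^ 2 / 8 * ∫ x, F x ^ 2 * h x ^ 2 ∂μ ≤
      1 / 2 * (lam₀⁻¹ * ∫ x, ∫ y, h x * K x y * h y * (F x - F y) ^ 2 ∂μ ∂μ) := by
    rw [← hvar, ← hdir]; exact hcheeger
  set I : ℝ := ∫ x, ∫ y, h x * K x y * h y * (F x - F y) ^ 2 ∂μ ∂μ with hIdef
  set X2 : ℝ := ∫ x, F x ^ 2 * h x ^ 2 ∂μ with hX2
  have hE' : lam₀ * (k ^ 2 / 8 * X2) ≤ 1 / 2 * I := by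
    have := mul_le_mul_of_nonneg_left hE hlam₀.le
    calc lam₀ * (k ^ 2 / 8 * X2) ≤ lam₀ * (1 / 2 * (lam₀⁻¹ * I)) := this
      _ = 1 / 2 * I := by field_simp
  nlinarith [hE']

/-! ## The excited spectrum under a conductance bound -/

/-- **Eigenvalue bound from conductance** (the spectral reading of Lawler–Sokal Thm 2.1 for the ground-state transform): in the setting of
`integral_mul_kernel_mul_le_of_conductance`, with `h ≥ h₀ > 0`, every unit eigenvector `ψ` of the `L²` operator `A` of `K` with eigenvalue
`λ_ψ > 0` and `∫ h ψ dμ = 0` satisfies `λ_ψ ≤ λ₀ (1 − k²/8)` (trial function `F = ψ/h`, through the bounded version `λ_ψ⁻¹ κψ` of `ψ`). -/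
theorem eigenvalue_le_of_conductance
    (hK : StronglyMeasurable (uncurry K)) (hC : ∀ x y, ‖K x y‖ ≤ C) (hsymm : ∀ x y, K x y = K y x) (hKnn : ∀ x y, 0 ≤ K x y)
    {h : X → ℝ} (hhm : Measurable h) {B : ℝ} (hhB : ∀ x, ‖h x‖ ≤ B) {h₀ : ℝ} (hh₀ : 0 < h₀) (hhlow : ∀ x, h₀ ≤ h x)
    {lam₀ : ℝ} (hlam₀ : 0 < lam₀) (heig : ∀ x, ∫ y, K x y * h y ∂μ = lam₀ * h x) (hnorm : ∫ x, h x ^ 2 ∂μ = 1)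
    {k : ℝ} (hk : 0 ≤ k)
    (hcond : ∀ A : Set X, MeasurableSet A →
      k * (∫ x in A, h x ^ 2 ∂μ) * (1 - ∫ x in A, h x ^ 2 ∂μ) ≤
        (∫ x in A, h x ^ 2 ∂μ) - lam₀⁻¹ * ∫ x in A, ∫ y in A, h x * K x y * h y ∂μ ∂μ)
    {A : Lp ℝ 2 μ →L[ℝ] Lp ℝ 2 μ} (hA : ∀ φ : Lp ℝ 2 μ, (A φ : X → ℝ) =ᵐ[μ] fun x => ∫ y, K x y * φ y ∂μ)
    {ψ : Lp ℝ 2 μ} {lamψ : ℝ} (hψ : A ψ = lamψ • ψ) (hlamψ : 0 < lamψ) (hψ1 : ‖ψ‖ = 1)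
    (horth : ∫ x, h x * ψ x ∂μ = 0) :
    lamψ ≤ lam₀ * (1 - k ^ 2 / 8) := by
  have hμu : μ (univ : Set X) ≠ 0 := by rw [measure_univ]; exact one_ne_zero
  obtain ⟨x₀, -⟩ : (univ : Set X).Nonempty := nonempty_of_measure_ne_zero hμu
  have hC0 : 0 ≤ C := (norm_nonneg _).trans (hC x₀ x₀)
  have hh0 : ∀ x, 0 ≤ h x := fun x => hh₀.le.trans (hhlow x)
  have hhne : ∀ x, h x ≠ 0 := fun x => (hh₀.trans_le (hhlow x)).ne'
  -- the bounded version `g = λ_ψ⁻¹ κψ` of `ψ`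
  set g : X → ℝ := fun x => lamψ⁻¹ * ∫ y, K x y * ψ y ∂μ with hg
  have hgm : Measurable g := measurable_const.mul (stronglyMeasurable_integral_kernel_mul hK ψ).measurable
  have hgb : ∀ x, ‖g x‖ ≤ lamψ⁻¹ * C := by
    intro x
    rw [hg, norm_mul, Real.norm_eq_abs, abs_of_pos (inv_pos.2 hlamψ), Real.norm_eq_abs]
    refine mul_le_mul_of_nonneg_left ?_ (inv_nonneg.2 hlamψ.le)
    have h1 := abs_integral_kernel_mul_le (μ := μ) hC hC0 ψ x
    rw [probReal_univ, Real.sqrt_one, mul_one, hψ1, mul_one] at h1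
    exact h1
  have hgψ : g =ᵐ[μ] ψ := by
    have h2 : (A ψ : X → ℝ) =ᵐ[μ] fun x => lamψ * ψ x := by
      rw [hψ]
      filter_upwards [Lp.coeFn_smul lamψ ψ] with x hx
      rw [hx, Pi.smul_apply, smul_eq_mul]
    filter_upwards [hA ψ, h2] with x hx h2x
    simp only [hg]
    rw [← hx, h2x, ← mul_assoc, inv_mul_cancel₀ hlamψ.ne', one_mul]
  -- the trial function `F = g / h`
  set F : X → ℝ := fun x => g x / h x with hF
  have hFm : Measurable F := hgm.div hhm
  have hFb : ∀ x, |F x| ≤ lamψ⁻¹ * C / h₀ := by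
    intro x
    rw [hF, abs_div, abs_of_pos (hh₀.trans_le (hhlow x))]
    have := hgb x
    rw [Real.norm_eq_abs] at this
    exact div_le_div₀ (mul_nonneg (inv_nonneg.2 hlamψ.le) hC0) this hh₀ (hhlow x)
  have hFh : ∀ x, F x * h x = g x := fun x => div_mul_cancel₀ _ (hhne x)
  have hF0 : ∫ x, F x * h x ^ 2 ∂μ = 0 := by
    have e1 : ∀ x, F x * h x ^ 2 = h x * g x := fun x => by rw [sq, ← mul_assoc, hFh x, mul_comm]
    simp_rw [e1]
    rw [← horth]
    refine integral_congr_ae ?_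
    filter_upwards [hgψ] with x hx
    rw [hx]
  have hmain := integral_mul_kernel_mul_le_of_conductance (μ := μ) hK hC hsymm hKnn hhm hhB hh0 hlam₀ heig hnorm hk
    hcond hFm hFb hF0
  -- `∫∫ (Fh) K (Fh) = ⟪ψ, Aψ⟫ = λ_ψ` and `∫ F²h² = ‖ψ‖² = 1`
  have hL : ∫ x, ∫ y, (F x * h x) * K x y * (F y * h y) ∂μ ∂μ = lamψ := by
    simp_rw [hFh]
    have e2 : ∀ x, ∫ y, g x * K x y * g y ∂μ = g x * ∫ y, K x y * g y ∂μ := fun x => by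
      rw [← integral_const_mul]
      refine integral_congr_ae (Eventually.of_forall fun y => ?_); ring
    simp_rw [e2]
    have e3 : ∀ x, ∫ y, K x y * g y ∂μ = ∫ y, K x y * ψ y ∂μ := fun x =>
      integral_congr_ae (by filter_upwards [hgψ] with y hy; rw [hy])
    simp_rw [e3]
    have e4 : ∫ x, g x * ∫ y, K x y * ψ y ∂μ ∂μ = ∫ x, ψ x * ∫ y, K x y * ψ y ∂μ ∂μ :=
      integral_congr_ae (by filter_upwards [hgψ] with x hx; rw [hx])
    rw [e4, ← inner_kernelOp_eq_integral hA ψ ψ, hψ, inner_smul_right, real_inner_self_eq_norm_sq, hψ1]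
    ring
  have hR : ∫ x, F x ^ 2 * h x ^ 2 ∂μ = 1 := by
    have e5 : ∀ x, F x ^ 2 * h x ^ 2 = g x * g x := fun x => by rw [← mul_pow, hFh x, sq]
    simp_rw [e5]
    have e6 : ∫ x, g x * g x ∂μ = ∫ x, ψ x * ψ x ∂μ :=
      integral_congr_ae (by filter_upwards [hgψ] with x hx; rw [hx])
    rw [e6, ← inner_eq_integral ψ ψ, real_inner_self_eq_norm_sq, hψ1, one_pow]
  rw [hL, hR, mul_one] at hmain
  exact hmain

end Summit.QuantumFields.YangMills.Cruxes.IR.VacuumEscape.GroundState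

end
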